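import Mathlib
import Summits.NavierStokesRegularity.NavierStokesRegularity.Theorems.ThreadingFluxSilentShellsJiuXinSlabLimit
import HarnessLib

/-!
# Crux `PoloidalLiouville` (stmt-NavierStokesRegularity-1222, W1), crux idea «silent-shells»:
# towards the PRINTED Jiu–Xin Liouville theorem — the slab identity

Third file for `SilentShells.jiuXin2008_thm53`.  For a `C¹` steady Euler pair `(U, P)` on `ℝ³` (`div U = 0`,
`(U·∇)U + ∇P = 0`) WITHOUT swirl, with `U ∈ L²` and `P → p₀` at infinity, and every `ε ≠ 0`, `Z > 0`:

  `∫ η_Z² |U_h|² (ε²−ρ²)/(ρ²+ε²)²  +  ∫ 2η_Z (d_Z U₂) ⟪U, G_ε⟫  =  −∫ η_Z² (P − p₀) · 2ε²/(ρ²+ε²)²`      (`slab_identity`),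

obtained from the test-field virial identity against `χ_R η_Z² G_ε` by `R → ∞`: the cut-off error terms are
`≤ (2S/3R|ε|)‖U‖²_{L²}` and `≤ sup_{‖x‖≥R}|P−p₀|·(2S/3)·vol{ρ²≤4,|x₂|≤2Z}` (cylinder volume scaling of
`ThreadingFluxSilentShellsJiuXinSlabLimit`).  No axisymmetry is needed for this step; it is the regularised form of
[JiuXin2008, (3.24)] in a slab.

All `--supports stmt-NavierStokesRegularity-1222 --as helper`; W1 movement 0; NS regularity is NOT proved by any of this.
-/

-- the summit and its single problem share the name (D-0017 nested layout)
set_option linter.dupNamespace false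

noncomputable section

namespace Summit.NavierStokesRegularity.NavierStokesRegularity.Theorems.PoloidalLiouville.SilentShells

open Set Function Filter MeasureTheory Topology Metric
open scoped Topology RealInnerProductSpace ENNReal
open Literature.Analysis.FluidPDE
open Summit.NavierStokesRegularity.NavierStokesRegularity.Theorems.PoloidalLiouville.HorizonTower (E3)

namespace JiuXin

section Euler

variable {U : E3 → E3} {P : E3 → ℝ}

/-- **The slab identity** (`R → ∞` in the virial identity against `χ_R η_Z² G_ε`). -/
theorem slab_identity (hU : ContDiff ℝ 1 U) (hP : ContDiff ℝ 1 P) (hdiv : VectorCalculus.IsDivFree U)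
    (hE : ∀ x, convect U U x + gradient P x = 0) (hsw : HasNoSwirl U) (hL2 : MemLp U 2 (volume : Measure E3))
    {p₀ : ℝ} (hp : Tendsto P (cocompact E3) (𝓝 p₀)) {Z ε : ℝ} (hZ : 0 < Z) (hε : ε ≠ 0) :
    (∫ x, vertCut Z x ^ 2 * ((U x 0 * U x 0 + U x 1 * U x 1) * ((ε ^ 2 - cylSq x) / (cylSq x + ε ^ 2) ^ 2))) +
      ∫ x, 2 * vertCut Z x * (vertCutCoeff Z x * U x 2) * ⟪U x, testField ε x⟫ =
        -∫ x, vertCut Z x ^ 2 * ((P x - p₀) * (2 * ε ^ 2 / (cylSq x + ε ^ 2) ^ 2)) := by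
  -- standing facts
  have hUc : Continuous U := hU.continuous
  have hPc : Continuous P := hP.continuous
  have hU2 : Integrable (fun x => ‖U x‖ ^ 2) (volume : Measure E3) := integrable_norm_sq_of_memLp hUc hL2
  obtain ⟨B, hB0, hB⟩ := exists_bound_of_tendsto_cocompact hPc hp
  obtain ⟨S, hS0, hS⟩ := exists_deriv_smoothTransition_bound
  have hε' : 0 < |ε| := abs_pos.mpr hε
  have hηc : Continuous (vertCut Z) := (contDiff_vertCut (n := 0) Z).continuous
  have hdc : Continuous (vertCutCoeff Z) := by
    unfold vertCutCoeff
    refine ((((Real.smoothTransition.contDiff (n := 1)).continuous_deriv le_rfl).comp ?_).mul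
      continuous_const).mul (EuclideanSpace.proj (2 : Fin 3) : E3 →L[ℝ] ℝ).continuous
    exact (continuous_const.sub ((EuclideanSpace.proj (2 : Fin 3) : E3 →L[ℝ] ℝ).continuous.pow 2)).mul
      continuous_const
  have hkc : Continuous fun x : E3 => 2 * ε ^ 2 / (cylSq x + ε ^ 2) ^ 2 :=
    continuous_const.div ((continuous_cylSq.add continuous_const).pow 2)
      fun x => pow_ne_zero 2 (cylSq_add_sq_pos hε x).ne'
  have hrc : Continuous fun x : E3 => (ε ^ 2 - cylSq x) / (cylSq x + ε ^ 2) ^ 2 :=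
    (continuous_const.sub continuous_cylSq).div ((continuous_cylSq.add continuous_const).pow 2)
      fun x => pow_ne_zero 2 (cylSq_add_sq_pos hε x).ne'
  have hGc : Continuous (testField ε) := continuous_testField hε
  have hhs : Continuous fun x => U x 0 * U x 0 + U x 1 * U x 1 := continuous_horSq hUc
  have hUG : Continuous fun x => ⟪U x, testField ε x⟫ := hUc.inner hGc
  have hcc : ∀ R, Continuous (cutoffCoeff R) := continuous_cutoffCoeff
  have hχc : ∀ R, Continuous (cutoff R) := fun R => (contDiff_cutoff (n := 0) R).continuous
  -- the three limiting integrands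
  set F₁ : E3 → ℝ := fun x => vertCut Z x ^ 2 *
    ((U x 0 * U x 0 + U x 1 * U x 1) * ((ε ^ 2 - cylSq x) / (cylSq x + ε ^ 2) ^ 2)) with hF₁
  set F₃ : E3 → ℝ := fun x => 2 * vertCut Z x * (vertCutCoeff Z x * U x 2) * ⟪U x, testField ε x⟫ with hF₃
  set F₄ : E3 → ℝ := fun x => vertCut Z x ^ 2 * ((P x - p₀) * (2 * ε ^ 2 / (cylSq x + ε ^ 2) ^ 2)) with hF₄
  -- the two error integrands
  set M₂ : ℝ → E3 → ℝ := fun R x => vertCut Z x ^ 2 * (cutoffCoeff R x * ⟪x, U x⟫) * ⟪U x, testField ε x⟫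
    with hM₂
  set M₅ : ℝ → E3 → ℝ := fun R x => (P x - p₀) * (vertCut Z x ^ 2 * cutoffCoeff R x *
    (cylSq x / (cylSq x + ε ^ 2))) with hM₅
  -- integrability of F₁, F₃, F₄
  have hF₁i : Integrable F₁ (volume : Measure E3) := by
    refine Integrable.mono' (hU2.const_mul (ε ^ 2)⁻¹) ((hηc.pow 2).mul (hhs.mul hrc)).aestronglyMeasurable
      (Eventually.of_forall fun x => ?_)
    have hq := cylSq_add_sq_pos hε x
    have hη2 : vertCut Z x ^ 2 ≤ 1 := pow_le_one₀ (vertCut_nonneg Z x) (vertCut_le_one Z x)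
    have hs0 := horSq_nonneg U x
    have hs1 := horSq_le_norm_sq (U x)
    have hr : |(ε ^ 2 - cylSq x) / (cylSq x + ε ^ 2) ^ 2| ≤ (ε ^ 2)⁻¹ := by
      rw [abs_div, abs_of_pos (pow_pos hq 2), div_le_iff₀ (pow_pos hq 2)]
      have h1 : |ε ^ 2 - cylSq x| ≤ cylSq x + ε ^ 2 :=
        abs_le.mpr ⟨by nlinarith [cylSq_nonneg x, sq_nonneg ε], by nlinarith [cylSq_nonneg x, sq_nonneg ε]⟩
      have h2 : cylSq x + ε ^ 2 ≤ (ε ^ 2)⁻¹ * (cylSq x + ε ^ 2) ^ 2 := by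
        rw [le_inv_mul_iff₀ (by positivity)]
        nlinarith [cylSq_nonneg x, sq_nonneg ε]
      exact h1.trans h2
    rw [hF₁, Real.norm_eq_abs, abs_mul, abs_mul, abs_of_nonneg (sq_nonneg _), abs_of_nonneg hs0]
    calc vertCut Z x ^ 2 * ((U x 0 * U x 0 + U x 1 * U x 1) * |(ε ^ 2 - cylSq x) / (cylSq x + ε ^ 2) ^ 2|)
        ≤ 1 * (‖U x‖ ^ 2 * (ε ^ 2)⁻¹) := by gcongr
      _ = (ε ^ 2)⁻¹ * ‖U x‖ ^ 2 := by ring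
  have hF₃i : Integrable F₃ (volume : Measure E3) := by
    refine Integrable.mono' (hU2.const_mul (2 * (4 * S / (3 * Z)) / (2 * |ε|)))
      (((continuous_const.mul hηc).mul (hdc.mul ((EuclideanSpace.proj (2 : Fin 3) : E3 →L[ℝ] ℝ).continuous.comp
        hUc))).mul hUG).aestronglyMeasurable (Eventually.of_forall fun x => ?_)
    rw [hF₃, Real.norm_eq_abs]
    have h1 : |vertCut Z x| ≤ 1 := by rw [abs_of_nonneg (vertCut_nonneg Z x)]; exact vertCut_le_one Z x
    have h2 := abs_vertCutCoeff_le hS0 hS hZ x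
    have h3 := ((pow_le_pow_iff_left₀ (abs_nonneg _) (norm_nonneg _) two_ne_zero).mp (sq_abs_apply_two_le_norm_sq (U x)))
    have h4 := abs_inner_testField_le hε (U x) x
    calc |2 * vertCut Z x * (vertCutCoeff Z x * U x 2) * ⟪U x, testField ε x⟫|
        = 2 * |vertCut Z x| * (|vertCutCoeff Z x| * |U x 2|) * |⟪U x, testField ε x⟫| := by
          simp only [abs_mul, abs_two]
      _ ≤ 2 * 1 * (4 * S / (3 * Z) * ‖U x‖) * (‖U x‖ / (2 * |ε|)) := by gcongr
      _ = 2 * (4 * S / (3 * Z)) / (2 * |ε|) * ‖U x‖ ^ 2 := by ring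
  have hF₄i : Integrable F₄ (volume : Measure E3) := by
    refine integrable_of_le_vertCut_weight (K := B * (2 * ε ^ 2)) hZ (by positivity : (0 : ℝ) < ε ^ 2)
      ((hηc.pow 2).mul ((hPc.sub continuous_const).mul hkc)).aestronglyMeasurable fun x => ?_
    rw [hF₄, Real.norm_eq_abs, abs_mul, abs_mul, abs_of_nonneg (sq_nonneg _),
      abs_of_nonneg (by positivity : (0 : ℝ) ≤ 2 * ε ^ 2 / (cylSq x + ε ^ 2) ^ 2)]
    have := hB x
    calc vertCut Z x ^ 2 * (|P x - p₀| * (2 * ε ^ 2 / (cylSq x + ε ^ 2) ^ 2))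
        ≤ vertCut Z x ^ 2 * (B * (2 * ε ^ 2 / (cylSq x + ε ^ 2) ^ 2)) := by gcongr
      _ = B * (2 * ε ^ 2) * (vertCut Z x ^ 2 / (cylSq x + ε ^ 2) ^ 2) := by ring
  -- the identity at finite `R`
  have hI : ∀ R : ℝ, 0 < R →
      (∫ x, cutoff R x * F₁ x) + (∫ x, M₂ R x) + (∫ x, cutoff R x * F₃ x) =
        -(∫ x, cutoff R x * F₄ x) - ∫ x, M₅ R x := by
    intro R hR
    have hv := virial_identity_test hU hP hdiv hE (contDiff_slabField (R := R) (Z := Z) hε)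
      (hasCompactSupport_slabField hR Z ε) p₀
    -- pointwise forms of both integrands
    have hL : ∀ x, ⟪U x, fderiv ℝ (fun y => slabWeight R Z y • testField ε y) x (U x)⟫ =
        cutoff R x * F₁ x + M₂ R x + cutoff R x * F₃ x := by
      intro x
      rw [inner_fderiv_slabField hε, inner_fderiv_testField_of_swirl_eq_zero hε (hsw x), slabWeightDeriv,
        slabWeight, hF₁, hF₃, hM₂]
      ring
    have hRt : ∀ x, (P x - p₀) * VectorCalculus.divergence (fun y => slabWeight R Z y • testField ε y) x =
        cutoff R x * F₄ x + M₅ R x := by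
      intro x
      rw [divergence_slabField hε, slabWeight, hF₄, hM₅]
      ring
    simp_rw [hL, hRt] at hv
    -- integrability at finite `R` (compact supports)
    have hcs : HasCompactSupport (cutoff R) := hasCompactSupport_cutoff hR
    have hccs : HasCompactSupport (cutoffCoeff R) := hasCompactSupport_cutoffCoeff hR
    have hi1 : Integrable (fun x => cutoff R x * F₁ x) (volume : Measure E3) :=
      ((hχc R).mul ((hηc.pow 2).mul (hhs.mul hrc))).integrable_of_hasCompactSupport hcs.mul_right
    have hi2 : Integrable (M₂ R) (volume : Measure E3) := by
      refine ((((hηc.pow 2).mul ((hcc R).mul (continuous_id.inner hUc))).mul hUG)).integrable_of_hasCompactSupport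
        (hccs.mono fun x hx => ?_)
      rw [Function.mem_support] at hx ⊢
      contrapose! hx
      simp [hx]
    have hi3 : Integrable (fun x => cutoff R x * F₃ x) (volume : Measure E3) :=
      ((hχc R).mul (((continuous_const.mul hηc).mul (hdc.mul ((EuclideanSpace.proj (2 : Fin 3) :
        E3 →L[ℝ] ℝ).continuous.comp hUc))).mul hUG)).integrable_of_hasCompactSupport hcs.mul_right
    have hi4 : Integrable (fun x => cutoff R x * F₄ x) (volume : Measure E3) :=
      ((hχc R).mul ((hηc.pow 2).mul ((hPc.sub continuous_const).mul hkc))).integrable_of_hasCompactSupport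
        hcs.mul_right
    have hi5 : Integrable (M₅ R) (volume : Measure E3) := by
      refine ((hPc.sub continuous_const).mul (((hηc.pow 2).mul (hcc R)).mul
        (continuous_cylSq.div (continuous_cylSq.add continuous_const) fun x => (cylSq_add_sq_pos hε x).ne')))
        |>.integrable_of_hasCompactSupport (hccs.mono fun x hx => ?_)
      rw [Function.mem_support] at hx ⊢
      contrapose! hx
      simp [hx]
    have hi12 : Integrable (fun x => cutoff R x * F₁ x + M₂ R x) (volume : Measure E3) := hi1.add hi2
    rw [integral_add hi12 hi3, integral_add hi1 hi2, integral_add hi4 hi5] at hv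
    linarith
  -- limits of the five terms
  have hT1 := tendsto_integral_cutoff_mul hF₁i
  have hT3 := tendsto_integral_cutoff_mul hF₃i
  have hT4 := tendsto_integral_cutoff_mul hF₄i
  have hT2 : Tendsto (fun R : ℝ => ∫ x, M₂ R x) atTop (𝓝 0) := by
    have hbound : ∀ R : ℝ, 0 < R → ‖∫ x, M₂ R x‖ ≤ (2 * S / (3 * |ε|) * ∫ x, ‖U x‖ ^ 2) / R := by
      intro R hR
      have hle : ∀ x, ‖M₂ R x‖ ≤ 2 * S / (3 * R * |ε|) * ‖U x‖ ^ 2 := by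
        intro x
        rw [hM₂, Real.norm_eq_abs, abs_mul, abs_mul, abs_of_nonneg (sq_nonneg _)]
        have h1 : vertCut Z x ^ 2 ≤ 1 := pow_le_one₀ (vertCut_nonneg Z x) (vertCut_le_one Z x)
        have h2 := abs_cutoffCoeff_mul_inner_le hS0 hS hR x (U x)
        have h3 := abs_inner_testField_le hε (U x) x
        calc vertCut Z x ^ 2 * |cutoffCoeff R x * ⟪x, U x⟫| * |⟪U x, testField ε x⟫|
            ≤ 1 * (4 * S / (3 * R) * ‖U x‖) * (‖U x‖ / (2 * |ε|)) := by gcongr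
          _ = 2 * S / (3 * R * |ε|) * ‖U x‖ ^ 2 := by field_simp; ring
      calc ‖∫ x, M₂ R x‖ ≤ ∫ x, 2 * S / (3 * R * |ε|) * ‖U x‖ ^ 2 :=
            norm_integral_le_of_norm_le (hU2.const_mul _) (Eventually.of_forall hle)
        _ = (2 * S / (3 * |ε|) * ∫ x, ‖U x‖ ^ 2) / R := by rw [integral_const_mul]; field_simp
    refine squeeze_zero_norm' ?_ ((tendsto_const_nhds (x := 2 * S / (3 * |ε|) * ∫ x, ‖U x‖ ^ 2)).div_atTop
      tendsto_id)
    filter_upwards [eventually_gt_atTop (0 : ℝ)] with R hR using hbound R hR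
  have hT5 : Tendsto (fun R : ℝ => ∫ x, M₅ R x) atTop (𝓝 0) := by
    set V : ℝ := (volume (cyl 4 (2 * Z))).toReal with hV
    have hV0 : 0 ≤ V := ENNReal.toReal_nonneg
    rw [Metric.tendsto_atTop]
    intro δ hδ
    -- choose `η` with `η (2S/3) V < δ`, then `R₀` with `|P − p₀| ≤ η` off `B(0,R₀)`
    set η : ℝ := δ / (2 * S / 3 * V + 1) with hη
    have hη0 : 0 < η := by positivity
    obtain ⟨R₀, hR₀, hfar⟩ := exists_radius_of_tendsto_cocompact hp hη0
    refine ⟨R₀, fun R hR => ?_⟩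
    have hRpos : 0 < R := hR₀.trans_le hR
    rw [dist_zero_right]
    have hzero : ∀ x, x ∉ cyl (4 * R ^ 2) (2 * Z) → M₅ R x = 0 := by
      intro x hx
      simp only [cyl, mem_setOf_eq, not_and_or, not_le] at hx
      rcases hx with hx | hx
      · have hn : 2 * R < ‖x‖ := by
          have h1 : (2 * R) ^ 2 < ‖x‖ ^ 2 := by
            rw [norm_sq_eq_cylSq_add]; nlinarith [sq_nonneg (x 2)]
          exact (pow_lt_pow_iff_left₀ (by positivity) (norm_nonneg _) two_ne_zero).mp h1
        simp [hM₅, cutoffCoeff_eq_zero_of_lt_norm hRpos hn]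
      · simp [hM₅, vertCut_eq_zero hZ hx.le]
    have hle : ∀ x ∈ cyl (4 * R ^ 2) (2 * Z), ‖M₅ R x‖ ≤ η * (2 * S / (3 * R ^ 2)) := by
      intro x _
      rw [hM₅, Real.norm_eq_abs, abs_mul, abs_mul, abs_mul, abs_of_nonneg (sq_nonneg (vertCut Z x))]
      by_cases hxR : ‖x‖ < R
      · rw [cutoffCoeff_eq_zero_of_norm_lt hRpos hxR]; simp; positivity
      · rw [not_lt] at hxR
        have h1 := hfar x (hR.trans hxR)
        have h2 : vertCut Z x ^ 2 ≤ 1 := pow_le_one₀ (vertCut_nonneg Z x) (vertCut_le_one Z x)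
        have h3 := abs_cutoffCoeff_le hS R x
        have h4 : |cylSq x / (cylSq x + ε ^ 2)| ≤ 1 := by
          have hq := cylSq_add_sq_pos hε x
          rw [abs_of_nonneg (div_nonneg (cylSq_nonneg x) hq.le)]
          exact div_le_one_of_le₀ (by nlinarith [sq_nonneg ε]) hq.le
        calc |P x - p₀| * (vertCut Z x ^ 2 * |cutoffCoeff R x| * |cylSq x / (cylSq x + ε ^ 2)|)
            ≤ η * (1 * (2 * S / (3 * R ^ 2)) * 1) := by gcongr
          _ = η * (2 * S / (3 * R ^ 2)) := by ring
    have hmain := norm_integral_le_of_cyl hRpos (by positivity) hzero hle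
    calc ‖∫ x, M₅ R x‖ ≤ η * (2 * S / (3 * R ^ 2)) * (R ^ 2 * V) := hmain
      _ = η * (2 * S / 3 * V) := by field_simp
      _ < δ := by
          rw [hη, div_mul_eq_mul_div, div_lt_iff₀ (by positivity)]
          nlinarith [mul_nonneg hS0 hV0]
  -- conclude by uniqueness of limits along `R → ∞`
  have hlimL : Tendsto (fun R : ℝ => (∫ x, cutoff R x * F₁ x) + (∫ x, M₂ R x) + ∫ x, cutoff R x * F₃ x) atTop
      (𝓝 ((∫ x, F₁ x) + 0 + ∫ x, F₃ x)) := (hT1.add hT2).add hT3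
  have hlimR : Tendsto (fun R : ℝ => -(∫ x, cutoff R x * F₄ x) - ∫ x, M₅ R x) atTop
      (𝓝 (-(∫ x, F₄ x) - 0)) := hT4.neg.sub hT5
  have heq : (fun R : ℝ => (∫ x, cutoff R x * F₁ x) + (∫ x, M₂ R x) + ∫ x, cutoff R x * F₃ x) =ᶠ[atTop]
      fun R : ℝ => -(∫ x, cutoff R x * F₄ x) - ∫ x, M₅ R x := by
    filter_upwards [eventually_gt_atTop (0 : ℝ)] with R hR using hI R hR
  have := tendsto_nhds_unique_of_eventuallyEq hlimL hlimR heq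
  rw [add_zero, sub_zero] at this
  exact this

end Euler

end JiuXin

end Summit.NavierStokesRegularity.NavierStokesRegularity.Theorems.PoloidalLiouville.SilentShells

end
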